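import Mathlib
import HarnessLib
import Summits.HubbardSuperconductivity.HubbardSuperconductivity.Theorems.KLProgrammeH10TwoPointLimitFramePerturbation
import Summits.HubbardSuperconductivity.HubbardSuperconductivity.Theorems.KLProgrammeH10TwoPointLimitPerturbedOffsetSectorCount
import Summits.HubbardSuperconductivity.HubbardSuperconductivity.Theorems.KLProgrammeH10TwoPointLimitPerturbedCountKappaStar

/-!
# Route `KLProgramme` — crux K1 `H10TwoPointLimit` (stmt-HubbardSuperconductivity-19938) / K3's ENGINE child:
# the moving-curve sector count ON ADMISSIBLE FRAMES — rows (F), (E), (V) of the sector-counting interface at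
# `δ := frameShift K ∘ toLp` for a `C₄ᵥ` frame `K : TrigPolyC4v`, keyed by the frame's `C²` size, and IN THE KL REGIME by `FrameOK`

Cell `gate-hubbard-kl`, seat p4 (C5a lead), g5; HOME/prover-p4/PORT-NOTE.md §7 (c).  The sector sums of the engine's one-scale step
(`stub_engine_step` of child 19662; BGM 2006 (2.76)/(2.80), Lemma F.1 / Cor. F.3 of DECOMP App. F) run over sectors cut from the curve
`{frameLevel μ K = 0}` of an admissible frame.  With the dictionary of `KLProgrammeH10TwoPointLimitFramePerturbation.lean`
(`δ_K = frameShift K ∘ toLp`: smooth, even, periodic, `|δ_K|, ‖Dδ_K‖, ‖D²δ_K‖ ≤ A, 2A, 4A`) the lineage's moving-curve counts become: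

* §1 row (E) `offsetSectorCount_frame_slack` / `offsetSectorCount_frame`: the sector count modulo `2πℤ²` against an arbitrary offset for
  the `e_K`-shells `|frameLevel μ K| ≤ π/2ⁿ`, `≤ K_c·2ⁿ·(n+1)` for every frame with `4A ≤ κ(window)`;
* §2 row (F) `countPairs_frame` (+ `countPairs_frame_explicit`, threshold `min(pcKappaStar (bandBounds a b), η₀/2)` on `4A`): Lemma F.1 on
  the frame's curve for every root selection;
* §3 row (V) `relCount_lastLeg_frame_le`: the one-determined-leg relative count on the frame's curve (`κ₁ := 2A < Dt_min`);
* §4 IN THE KL REGIME, keyed by `FrameOK R U (nScales β) ν K` with `klBetaMin ≤ β ≤ e^{c/U²}`: `offsetSectorCount_frameOK`,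
  `countPairs_frameOK` — thresholds `c ≤ c₃(R)`, `U ≤ U₀(R)` (the shape of Δ17's `EngineP4`), constants uniform in the frame, `β`, `U`, `c`:
  the counting input of the engine step on every admissible frame.

Everything is PROVED; no definitions, no named facts.  References: BGM 2006 Lemma 3.1 / (2.76) / (2.80) / App. A3
[cite: BenfattoGiulianiMastropietro2006]; HOME/prover-p4/PORT-NOTE.md §7(c), SECTOR-COUNTING-INTERFACE.md rows (E)/(F)/(V).
-/

noncomputable section

namespace Summit.HubbardSuperconductivity.HubbardSuperconductivity.Theorems.PerturbedFermiCurve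

set_option linter.dupNamespace false -- summit = problem name (single-conjunct summit), D-0017

open Classical
open Real Set Finset
open Literature.MathematicalPhysics.QuantumLattice Literature.MathematicalPhysics.QuantumLattice.BandSectorCounting
open Summit.HubbardSuperconductivity.HubbardSuperconductivity.Theorems.DispersionFlow
open Summit.HubbardSuperconductivity.HubbardSuperconductivity.Theorems.KLRegimeSplit

/-! ## §1 Row (E) on frames: the sector count modulo `2πℤ²` against an arbitrary offset for the `e_K`-shells -/

/-- **Row (E) — Cor. F.3 / BGM (2.76)–(2.80) ON THE CURVE OF A FRAME, slack form.**  For every level window `[μ₁, μ₂] ⊂ (-4, 0)` and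
slack `c_S ≥ 0` there are `κ > 0` and `K_c` such that for EVERY frame `K : TrigPolyC4v` whose correction has `C²` size `A` with `4A ≤ κ`
(`‖Dʲ(frameShift K)‖ ≤ A`, `j ≤ 2` — e.g. the fourth clause of `FrameGeometry`), every `μ ∈ [μ₁, μ₂]`, every scale `n`, reciprocal
vector `2πG` and offset `P₀`: the number of sector triples `(ω₂, ω₃, ω₄)` of angular width `π/2ⁿ` admitting momenta of the `e_K`-shell
`|frameLevel μ K| ≤ π/2ⁿ` in the prescribed sectors with `|P₀ + k₂ + k₃ + k₄ − 2πG|_∞ ≤ c_S·π/2ⁿ` is `≤ K_c·2ⁿ·(n+1)` — `K_c`, `κ` depend on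
the window and `c_S` only. [cite: BenfattoGiulianiMastropietro2006, Lemma 3.1 / (2.76) / (2.80) / App. A3] -/
theorem offsetSectorCount_frame_slack :
    ∀ μ₁ μ₂ cS : ℝ, -4 < μ₁ → μ₁ ≤ μ₂ → μ₂ < 0 → 0 ≤ cS → ∃ κ : ℝ, 0 < κ ∧ ∃ Kc : ℝ, 0 < Kc ∧
      ∀ (K : TrigPolyC4v) (A : ℝ), (∀ p : Momentum, ∀ j ≤ 2, ‖iteratedFDeriv ℝ j (frameShift K) p‖ ≤ A) → 4 * A ≤ κ →
      ∀ μ ∈ Set.Icc μ₁ μ₂, ∀ (n : ℕ) (G : Fin 2 → ℤ) (P₀ : Fin 2 → ℝ),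
      (((Finset.univ : Finset (Fin (sectorCount n) × Fin (sectorCount n) × Fin (sectorCount n))).filter
        (fun ω : Fin (sectorCount n) × Fin (sectorCount n) × Fin (sectorCount n) =>
        ∃ k : Fin 3 → Fin 2 → ℝ, (∀ j i, |k j i| ≤ Real.pi) ∧ (∀ j, |frameLevel μ K (WithLp.toLp 2 (k j))| ≤ sectorWidth n) ∧
          sectorIndex n (Complex.arg (⟨k 0 0, k 0 1⟩ : ℂ)) = (ω.1 : ℕ) ∧
          sectorIndex n (Complex.arg (⟨k 1 0, k 1 1⟩ : ℂ)) = (ω.2.1 : ℕ) ∧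
          sectorIndex n (Complex.arg (⟨k 2 0, k 2 1⟩ : ℂ)) = (ω.2.2 : ℕ) ∧
          (∀ i, |P₀ i + ∑ j, k j i - 2 * Real.pi * (G i : ℝ)| ≤ cS * sectorWidth n))).card : ℝ) ≤ Kc * 2 ^ n * ((n : ℝ) + 1) := by
  intro μ₁ μ₂ cS hμ₁ h12 hμ₂ hc
  obtain ⟨κ, hκ, Kc, hKc, h⟩ := offsetSectorCount_perturbed_slack μ₁ μ₂ cS hμ₁ h12 hμ₂ hc
  -- a margin so that a root selection of the frame's curve exists
  have ha : -4 < (μ₁ - 4) / 2 := by linarith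
  have hab : (μ₁ - 4) / 2 ≤ μ₂ / 2 := by linarith
  have hb : μ₂ / 2 < 0 := by linarith
  set m₀ := min (μ₁ - (μ₁ - 4) / 2) (μ₂ / 2 - μ₂) with hm₀def
  have hm₀ : 0 < m₀ := lt_min (by linarith) (by linarith)
  have hm1 : m₀ ≤ μ₁ - (μ₁ - 4) / 2 := min_le_left _ _; have hm2 : m₀ ≤ μ₂ / 2 - μ₂ := min_le_right _ _
  refine ⟨min κ m₀, lt_min hκ hm₀, Kc, hKc, ?_⟩
  intro K A hA hAκ μ hμ n G P₀
  have hA4 : 4 * A ≤ κ := hAκ.trans (min_le_left _ _)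
  have hAm : 4 * A ≤ m₀ := hAκ.trans (min_le_right _ _)
  have hA0 : 0 ≤ A := le_trans (norm_nonneg _) (hA 0 0 (by norm_num))
  obtain ⟨hδ, hκ₁, hκ₂⟩ := frameShift_toLp_small hA hA4
  -- a root selection of `{ε₀ + δ_K = μ}`
  set δ : (Fin 2 → ℝ) → ℝ := fun k => frameShift K (WithLp.toLp 2 k) with hδdef
  have hδsq : ∀ k : Fin 2 → ℝ, (∀ i, |k i| ≤ π) → |δ k| ≤ A := fun k _ => abs_frameShift_toLp_le hA k
  have hlo : (μ₁ - 4) / 2 ≤ μ - A := by linarith [hμ.1]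
  have hhi : μ + A ≤ μ₂ / 2 := by linarith [hμ.2]
  have hu := isBandFermiRadius_perturbedFermiRadius (bandBounds ha hab hb) (continuous_frameShift_toLp K) hδsq hlo hhi
  have hmain := h δ (contDiff_frameShift_toLp K (m := 2)) (frameShift_toLp_neg K) (frameShift_toLp_periodic K) hδ hκ₁ hκ₂ μ hμ
    (perturbedFermiRadius δ μ) hu n G P₀
  -- the two filters agree (`frameLevel_toLp`)
  have hfilt : ∀ ω : Fin (sectorCount n) × Fin (sectorCount n) × Fin (sectorCount n),
      (∃ k : Fin 3 → Fin 2 → ℝ, (∀ j i, |k j i| ≤ Real.pi) ∧ (∀ j, |frameLevel μ K (WithLp.toLp 2 (k j))| ≤ sectorWidth n) ∧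
          sectorIndex n (Complex.arg (⟨k 0 0, k 0 1⟩ : ℂ)) = (ω.1 : ℕ) ∧
          sectorIndex n (Complex.arg (⟨k 1 0, k 1 1⟩ : ℂ)) = (ω.2.1 : ℕ) ∧
          sectorIndex n (Complex.arg (⟨k 2 0, k 2 1⟩ : ℂ)) = (ω.2.2 : ℕ) ∧
          (∀ i, |P₀ i + ∑ j, k j i - 2 * Real.pi * (G i : ℝ)| ≤ cS * sectorWidth n)) ↔
      (∃ k : Fin 3 → Fin 2 → ℝ, (∀ j i, |k j i| ≤ Real.pi) ∧ (∀ j, |sqDispersion (k j) + δ (k j) - μ| ≤ sectorWidth n) ∧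
          sectorIndex n (Complex.arg (⟨k 0 0, k 0 1⟩ : ℂ)) = (ω.1 : ℕ) ∧
          sectorIndex n (Complex.arg (⟨k 1 0, k 1 1⟩ : ℂ)) = (ω.2.1 : ℕ) ∧
          sectorIndex n (Complex.arg (⟨k 2 0, k 2 1⟩ : ℂ)) = (ω.2.2 : ℕ) ∧
          (∀ i, |P₀ i + ∑ j, k j i - 2 * Real.pi * (G i : ℝ)| ≤ cS * sectorWidth n)) := by
    intro ω
    simp only [frameLevel_toLp, hδdef]
  rw [Finset.filter_congr fun ω _ => hfilt ω]
  exact hmain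

/-- **Row (E) on frames, exact constraint** (`c_S = 0`). [cite: BenfattoGiulianiMastropietro2006, Lemma 3.1 / (2.76) / (2.80) / App. A3] -/
theorem offsetSectorCount_frame :
    ∀ μ₁ μ₂ : ℝ, -4 < μ₁ → μ₁ ≤ μ₂ → μ₂ < 0 → ∃ κ : ℝ, 0 < κ ∧ ∃ Kc : ℝ, 0 < Kc ∧
      ∀ (K : TrigPolyC4v) (A : ℝ), (∀ p : Momentum, ∀ j ≤ 2, ‖iteratedFDeriv ℝ j (frameShift K) p‖ ≤ A) → 4 * A ≤ κ →
      ∀ μ ∈ Set.Icc μ₁ μ₂, ∀ (n : ℕ) (G : Fin 2 → ℤ) (P₀ : Fin 2 → ℝ),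
      (((Finset.univ : Finset (Fin (sectorCount n) × Fin (sectorCount n) × Fin (sectorCount n))).filter
        (fun ω : Fin (sectorCount n) × Fin (sectorCount n) × Fin (sectorCount n) =>
        ∃ k : Fin 3 → Fin 2 → ℝ, (∀ j i, |k j i| ≤ Real.pi) ∧ (∀ j, |frameLevel μ K (WithLp.toLp 2 (k j))| ≤ sectorWidth n) ∧
          sectorIndex n (Complex.arg (⟨k 0 0, k 0 1⟩ : ℂ)) = (ω.1 : ℕ) ∧
          sectorIndex n (Complex.arg (⟨k 1 0, k 1 1⟩ : ℂ)) = (ω.2.1 : ℕ) ∧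
          sectorIndex n (Complex.arg (⟨k 2 0, k 2 1⟩ : ℂ)) = (ω.2.2 : ℕ) ∧
          (∀ i, P₀ i + ∑ j, k j i = 2 * Real.pi * (G i : ℝ)))).card : ℝ) ≤ Kc * 2 ^ n * ((n : ℝ) + 1) := by
  intro μ₁ μ₂ hμ₁ h12 hμ₂
  obtain ⟨κ, hκ, Kc, hKc, h⟩ := offsetSectorCount_frame_slack μ₁ μ₂ 0 hμ₁ h12 hμ₂ le_rfl
  refine ⟨κ, hκ, Kc, hKc, fun K A hA hAκ μ hμ n G P₀ => le_trans ?_ (h K A hA hAκ μ hμ n G P₀)⟩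
  exact_mod_cast Finset.card_le_card (Finset.monotone_filter_right _ fun ω _ hω => by
    obtain ⟨k, hk, hsh, h0, h1, h2, hsum⟩ := hω
    exact ⟨k, hk, hsh, h0, h1, h2, fun i => by rw [hsum i, sub_self, abs_zero, zero_mul]⟩)

/-! ## §2 Row (F) on frames: the uniform two-dimensional pair count (Lemma F.1) on the frame's curve -/

/-- **Row (F) — Lemma F.1 / route item `CountPairsOffset` ON THE CURVE OF A FRAME**: for every level range `[a, b] ⊂ (-4, 0)`, margin
`η₀` and tolerance `C_δ` there are `κ > 0` and `K_p` such that for every frame `K` with `C²` size `A`, `4A ≤ κ`, every interior `μ`, EVERY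
root selection `u` of the frame's curve `{ε₀ + δ_K = μ}` (e.g. `perturbedFermiRadius δ_K μ`, `isBandFermiRadius_perturbedFermiRadius_frame`), every offset `P` and every isotropic
grid: `#{(i, j) : |h^{E_K}_P(θ_i, θ_j)| ≤ C_δ w} ≤ K_p (J + 2 + log N)/w`. [cite: BenfattoGiulianiMastropietro2006, Lemma 3.1 / (2.76) / App. A3] -/
theorem countPairs_frame :
    ∀ a b : ℝ, -4 < a → a ≤ b → b < 0 → ∀ η₀ Cδ : ℝ, 0 < η₀ → 0 < Cδ →
      ∃ κ : ℝ, 0 < κ ∧ ∃ Kp : ℝ, 0 < Kp ∧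
        ∀ (K : TrigPolyC4v) (A : ℝ), (∀ p : Momentum, ∀ j ≤ 2, ‖iteratedFDeriv ℝ j (frameShift K) p‖ ≤ A) → 4 * A ≤ κ →
        ∀ μ : ℝ, μ ∈ Set.Icc a b → a ≤ μ - η₀ → μ + η₀ ≤ b →
        ∀ u : ℝ → ℝ, (∀ θ, IsBandFermiRadius (μ - frameShift K (WithLp.toLp 2 (u θ • dir θ))) θ (u θ)) →
        ∀ (P : ℝ × ℝ) (w : ℝ) (N Nh J : ℕ), 0 < w → w ≤ 1 → (N : ℝ) * w = 2 * Real.pi → (Nh : ℝ) * w = Real.pi → N = 2 * Nh →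
          (2 : ℝ) ^ J * w = Real.pi → Cδ * w ≤ η₀ / 2 →
          ((((Finset.range N ×ˢ Finset.range N).filter fun p : ℕ × ℕ =>
              |hfunE (fun k : Fin 2 → ℝ => frameShift K (WithLp.toLp 2 k)) u μ P (w / 2 + p.1 * w) (w / 2 + p.2 * w)| ≤ Cδ * w).card
              : ℝ)) ≤ Kp * ((J : ℝ) + 2 + Real.log N) / w := by
  intro a b ha hab hb η₀ Cδ hη₀ hCδ
  obtain ⟨κ, hκ, Kp, hKp, h⟩ := countPairs_perturbed a b ha hab hb η₀ Cδ hη₀ hCδ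
  refine ⟨κ, hκ, Kp, hKp, fun K A hA hAκ μ hμ hlo hhi u hu => ?_⟩
  obtain ⟨hδ, hκ₁, hκ₂⟩ := frameShift_toLp_small hA hAκ
  exact h _ (contDiff_frameShift_toLp K (m := 2)) (frameShift_toLp_neg K) hδ hκ₁ hκ₂ μ hμ hlo hhi u hu

/-- **Row (F) on frames with the EXPLICIT threshold**: the same count for every frame with `4A ≤ min(pcKappaStar (bandBounds a b), η₀/2)`
(the lineage's closed-form perturbation size), only `K_p` existential. [cite: BenfattoGiulianiMastropietro2006, Lemma 3.1 / (2.76) / App. A3] -/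
theorem countPairs_frame_explicit :
    ∀ (a b : ℝ) (ha : -4 < a) (hab : a ≤ b) (hb : b < 0) (η₀ Cδ : ℝ), 0 < η₀ → 0 < Cδ →
      ∃ Kp : ℝ, 0 < Kp ∧
        ∀ (K : TrigPolyC4v) (A : ℝ), (∀ p : Momentum, ∀ j ≤ 2, ‖iteratedFDeriv ℝ j (frameShift K) p‖ ≤ A) →
          4 * A ≤ min (pcKappaStar (bandBounds ha hab hb)) (η₀ / 2) →
        ∀ μ : ℝ, μ ∈ Set.Icc a b → a ≤ μ - η₀ → μ + η₀ ≤ b →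
        ∀ u : ℝ → ℝ, (∀ θ, IsBandFermiRadius (μ - frameShift K (WithLp.toLp 2 (u θ • dir θ))) θ (u θ)) →
        ∀ (P : ℝ × ℝ) (w : ℝ) (N Nh J : ℕ), 0 < w → w ≤ 1 → (N : ℝ) * w = 2 * Real.pi → (Nh : ℝ) * w = Real.pi → N = 2 * Nh →
          (2 : ℝ) ^ J * w = Real.pi → Cδ * w ≤ η₀ / 2 →
          ((((Finset.range N ×ˢ Finset.range N).filter fun p : ℕ × ℕ =>
              |hfunE (fun k : Fin 2 → ℝ => frameShift K (WithLp.toLp 2 k)) u μ P (w / 2 + p.1 * w) (w / 2 + p.2 * w)| ≤ Cδ * w).card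
              : ℝ)) ≤ Kp * ((J : ℝ) + 2 + Real.log N) / w := by
  intro a b ha hab hb η₀ Cδ hη₀ hCδ
  obtain ⟨Kp, hKp, h⟩ := countPairs_perturbed_explicit a b ha hab hb η₀ Cδ hη₀ hCδ
  refine ⟨Kp, hKp, fun K A hA hAκ μ hμ hlo hhi u hu => ?_⟩
  obtain ⟨hδ, hκ₁, hκ₂⟩ := frameShift_toLp_small hA hAκ
  exact h _ (contDiff_frameShift_toLp K (m := 2)) (frameShift_toLp_neg K) hδ hκ₁ hκ₂ μ hμ hlo hhi u hu

/-! ## §3 Row (V) on frames: the relative count with one determined leg on the frame's curve -/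

/-- **Row (V) — the one-determined-leg relative count ON THE CURVE OF A FRAME** (BGM (2.83)–(2.96) / FKT4 XXI.4(ii) input, all scales):
for a frame with `C²` size `A`, `2A < Dt_min`, the lineage's `relCount_lastLeg_perturbedCurve_le` with `κ₀ := A`, `κ₁ := 2A`: the other
legs range over arbitrary sets within `r i` of points `P i`, the last leg over the `e_K`-cells (`|ε₀ + δ_K − μ| ≤ η`, angular tolerance
`α`) of the grid; for every `G` the number of grid angles admitting momenta with `Σ sᵢ kᵢ + t k = 2πG` is
`≤ 3 (2π √2 (Σ rᵢ + (η + s_max Dt_min α)/(Dt_min − 2A))/(u_min w) + 1)`. [cite: BenfattoGiulianiMastropietro2006, §2.8 (2.83)–(2.96), App. A3] -/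
theorem relCount_lastLeg_frame_le {a b : ℝ} (B : BandBounds a b) {K : TrigPolyC4v} {A : ℝ}
    (hA : ∀ p : Momentum, ∀ j ≤ 2, ‖iteratedFDeriv ℝ j (frameShift K) p‖ ≤ A) (hADt : 2 * A < B.Dtmin) {μ : ℝ} {u : ℝ → ℝ}
    (hu : ∀ θ, IsBandFermiRadius (μ - frameShift K (WithLp.toLp 2 (u θ • dir θ))) θ (u θ))
    {N : ℕ} {w : ℝ} (hw : 0 < w) (hN : (N : ℝ) * w = 2 * π)
    {η α : ℝ} (hη : 0 ≤ η) (hα : 0 ≤ α) (hlo : a ≤ μ - A - η) (hhi : μ + A + η ≤ b)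
    {M : ℕ} (Aset : Fin M → Set (Fin 2 → ℝ)) (P : Fin M → Fin 2 → ℝ) (r : Fin M → ℝ) (hr : ∀ i, 0 ≤ r i)
    (hAset : ∀ i, ∀ k ∈ Aset i, ∀ c : Fin 2, |k c - P i c| ≤ r i)
    (s : Fin M → ℝ) (hs : ∀ i, s i = 1 ∨ s i = -1) (t : ℝ) (ht : t = 1 ∨ t = -1) (G : Fin 2 → ℤ) :
    ((((Finset.range N).filter fun ω : ℕ => ∃ ks : Fin M → Fin 2 → ℝ, ∃ k : Fin 2 → ℝ,
        (∀ i, ks i ∈ Aset i) ∧ (∀ c, |k c| ≤ π) ∧ |sqDispersion k + frameShift K (WithLp.toLp 2 k) - μ| ≤ η ∧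
        (∃ m : ℤ, |Complex.arg (⟨k 0, k 1⟩ : ℂ) + m * (2 * π) - (w / 2 + ω * w)| ≤ α) ∧
        ∀ c : Fin 2, (∑ i, s i * ks i c) + t * k c = 2 * π * G c).card : ℝ)) ≤
      3 * (2 * (π * (Real.sqrt 2 * ((∑ i, r i) + (η + B.smax * B.Dtmin * α) / (B.Dtmin - 2 * A)) / B.umin)) / w + 1) := by
  have hδ : ∀ k : Fin 2 → ℝ, (∀ i, |k i| ≤ π) → |frameShift K (WithLp.toLp 2 k)| ≤ A := fun k _ => abs_frameShift_toLp_le hA k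
  have hLip : ∀ k k' : Fin 2 → ℝ, (∀ i, |k i| ≤ π) → (∀ i, |k' i| ≤ π) →
      |frameShift K (WithLp.toLp 2 k) - frameShift K (WithLp.toLp 2 k')| ≤ 2 * A * ‖k - k'‖ := fun k k' hk hk' =>
    lipschitz_of_fderiv_le (δ := fun k : Fin 2 → ℝ => frameShift K (WithLp.toLp 2 k))
      (fun k _ => (differentiable_frameShift_toLp K) k)
      (fun k _ => norm_fderiv_frameShift_toLp_le hA k) hk hk'
  exact relCount_lastLeg_perturbedCurve_le B hδ hLip hADt hu hw hN hη hα hlo hhi Aset P r hr hAset s hs t ht G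

/-! ## §4 In the KL regime, keyed by `FrameOK` -/

/-- **Row (E) ON EVERY ADMISSIBLE FRAME IN THE KL REGIME** — the counting input of the engine's one-scale step on the frame's curve:
for every level window `[μ₁, μ₂] ⊂ (-4, 0)` (e.g. `klWindowC`), slack `c_S ≥ 0` and renormalisation package `R` (`Gfr ≥ 0`) there are
`c₃, U₀ > 0` and `K_c` such that for every regime constant `0 < c ≤ c₃`, coupling `0 < U ≤ U₀`, `klBetaMin ≤ β ≤ e^{c/U²}`, every
`μ ∈ [μ₁, μ₂]`, every frame `K` admissible at depth `nScales β` (`FrameOK R U (nScales β) ν K`, any `ν`) and every `n, G, P₀`: the number of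
sector triples admitting `e_K`-shell momenta with `|P₀ + k₂ + k₃ + k₄ − 2πG|_∞ ≤ c_S·π/2ⁿ` is `≤ K_c·2ⁿ·(n+1)` — `K_c` uniform in the
frame, `β`, `U`, `c`. [cite: BenfattoGiulianiMastropietro2006, Lemma 3.1 / (2.76) / (2.80) / App. A3] -/
theorem offsetSectorCount_frameOK :
    ∀ μ₁ μ₂ cS : ℝ, -4 < μ₁ → μ₁ ≤ μ₂ → μ₂ < 0 → 0 ≤ cS → ∀ R : RenConsts, (∀ j, 0 ≤ R.Gfr j) →
      ∃ c₃ : ℝ, 0 < c₃ ∧ ∃ U₀ : ℝ, 0 < U₀ ∧ ∃ Kc : ℝ, 0 < Kc ∧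
      ∀ c : ℝ, 0 < c → c ≤ c₃ → ∀ U : ℝ, 0 < U → U ≤ U₀ → ∀ β : ℝ, klBetaMin ≤ β → β ≤ Real.exp (c / U ^ 2) →
      ∀ μ ∈ Set.Icc μ₁ μ₂, ∀ (ν : ℝ) (K : TrigPolyC4v), FrameOK R U (nScales β) ν K →
      ∀ (n : ℕ) (G : Fin 2 → ℤ) (P₀ : Fin 2 → ℝ),
      (((Finset.univ : Finset (Fin (sectorCount n) × Fin (sectorCount n) × Fin (sectorCount n))).filter
        (fun ω : Fin (sectorCount n) × Fin (sectorCount n) × Fin (sectorCount n) =>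
        ∃ k : Fin 3 → Fin 2 → ℝ, (∀ j i, |k j i| ≤ Real.pi) ∧ (∀ j, |frameLevel μ K (WithLp.toLp 2 (k j))| ≤ sectorWidth n) ∧
          sectorIndex n (Complex.arg (⟨k 0 0, k 0 1⟩ : ℂ)) = (ω.1 : ℕ) ∧
          sectorIndex n (Complex.arg (⟨k 1 0, k 1 1⟩ : ℂ)) = (ω.2.1 : ℕ) ∧
          sectorIndex n (Complex.arg (⟨k 2 0, k 2 1⟩ : ℂ)) = (ω.2.2 : ℕ) ∧
          (∀ i, |P₀ i + ∑ j, k j i - 2 * Real.pi * (G i : ℝ)| ≤ cS * sectorWidth n))).card : ℝ) ≤ Kc * 2 ^ n * ((n : ℝ) + 1) := by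
  intro μ₁ μ₂ cS hμ₁ h12 hμ₂ hcS R hR
  obtain ⟨κ, hκ, Kc, hKc, h⟩ := offsetSectorCount_frame_slack μ₁ μ₂ cS hμ₁ h12 hμ₂ hcS
  obtain ⟨c₃, hc₃, U₀, hU₀, hthr⟩ := frame_thresholds hR hκ
  refine ⟨c₃, hc₃, U₀, hU₀, Kc, hKc, ?_⟩
  intro c hc hcle U hU hUle β hβmin hβc μ hμ ν K hK n G P₀
  exact h K _ (fun p j hj => norm_iteratedFDeriv_frameShift_le_of_frameOK_regime hR hc.le hβmin hβc hK p hj)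
    (hthr c U hc.le hcle hU hUle) μ hμ n G P₀

/-- **Row (F) ON EVERY ADMISSIBLE FRAME IN THE KL REGIME** (Lemma F.1 with frame-uniform `K_p`): thresholds `c₃, U₀` from `R` and the
window; every root selection of the frame's curve. [cite: BenfattoGiulianiMastropietro2006, Lemma 3.1 / (2.76) / App. A3] -/
theorem countPairs_frameOK :
    ∀ a b : ℝ, -4 < a → a ≤ b → b < 0 → ∀ η₀ Cδ : ℝ, 0 < η₀ → 0 < Cδ → ∀ R : RenConsts, (∀ j, 0 ≤ R.Gfr j) →
      ∃ c₃ : ℝ, 0 < c₃ ∧ ∃ U₀ : ℝ, 0 < U₀ ∧ ∃ Kp : ℝ, 0 < Kp ∧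
      ∀ c : ℝ, 0 < c → c ≤ c₃ → ∀ U : ℝ, 0 < U → U ≤ U₀ → ∀ β : ℝ, klBetaMin ≤ β → β ≤ Real.exp (c / U ^ 2) →
      ∀ (ν : ℝ) (K : TrigPolyC4v), FrameOK R U (nScales β) ν K →
        ∀ μ : ℝ, μ ∈ Set.Icc a b → a ≤ μ - η₀ → μ + η₀ ≤ b →
        ∀ u : ℝ → ℝ, (∀ θ, IsBandFermiRadius (μ - frameShift K (WithLp.toLp 2 (u θ • dir θ))) θ (u θ)) →
        ∀ (P : ℝ × ℝ) (w : ℝ) (N Nh J : ℕ), 0 < w → w ≤ 1 → (N : ℝ) * w = 2 * Real.pi → (Nh : ℝ) * w = Real.pi → N = 2 * Nh →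
          (2 : ℝ) ^ J * w = Real.pi → Cδ * w ≤ η₀ / 2 →
          ((((Finset.range N ×ˢ Finset.range N).filter fun p : ℕ × ℕ =>
              |hfunE (fun k : Fin 2 → ℝ => frameShift K (WithLp.toLp 2 k)) u μ P (w / 2 + p.1 * w) (w / 2 + p.2 * w)| ≤ Cδ * w).card
              : ℝ)) ≤ Kp * ((J : ℝ) + 2 + Real.log N) / w := by
  intro a b ha hab hb η₀ Cδ hη₀ hCδ R hR
  obtain ⟨κ, hκ, Kp, hKp, h⟩ := countPairs_frame a b ha hab hb η₀ Cδ hη₀ hCδ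
  obtain ⟨c₃, hc₃, U₀, hU₀, hthr⟩ := frame_thresholds hR hκ
  refine ⟨c₃, hc₃, U₀, hU₀, Kp, hKp, ?_⟩
  intro c hc hcle U hU hUle β hβmin hβc ν K hK
  exact h K _ (fun p j hj => norm_iteratedFDeriv_frameShift_le_of_frameOK_regime hR hc.le hβmin hβc hK p hj)
    (hthr c U hc.le hcle hU hUle)

end Summit.HubbardSuperconductivity.HubbardSuperconductivity.Theorems.PerturbedFermiCurve

end
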